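import Mathlib
import HarnessLib
import Literature.Computability.AlgebraicComplexity.ArithCircuit
import Literature.Computability.AlgebraicComplexity.CircuitDepth
import Literature.Computability.AlgebraicComplexity.StandardFamilies
import Literature.Computability.AlgebraicComplexity.DepthThreeChasmCircuits
import Literature.Computability.Complexity.Circuit
import Literature.Computability.Complexity.CircuitComposition
import Literature.Computability.Complexity.WorstCaseToMild
import Summits.ValiantsHypothesis.ValiantsHypothesis.Theorems.SuccinctLiftIntegerAdvice
import Summits.ValiantsHypothesis.ValiantsHypothesis.Theorems.SuccinctLiftCircuitCodes
import Summits.ValiantsHypothesis.ValiantsHypothesis.Theorems.SuccinctLiftDescriptionDial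
import Summits.ValiantsHypothesis.ValiantsHypothesis.Theorems.SuccinctLiftDescriptionCount
import Summits.ValiantsHypothesis.ValiantsHypothesis.Theorems.SuccinctLiftNaturalColumn

/-!
# Succinct lift — w11: the width pin is an artefact only below polynomial budget
# (prefix table circuits; PINNED TOP NOTCH = TOP NOTCH, for every depth function)

Route `route-ValiantsHypothesis-SuccinctLift` (lens 2: natural-proofs / succinctness axis), generation 9; closes the
typing debt recorded by the standing critic (cycle 1, g8 ruling, W-item w1).

The description dial of the route has notches `SuccinctClass β Δ n c` (code word of a constant-free depth-`Δ(n)`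
witness with `n^c + c` wires, described from a `w`-bit address by a `B₂`-circuit of `β n c` gates, `w` FREE) and the
WIDTH-PINNED notches `PinnedClass Δ n c (canonWidth n c) (β n c)` of `SuccinctLiftDescriptionCount.lean`
(address width pinned to `canonWidth n c = ⌊log₂ codeLen n c⌋ + 1`, the width that addresses every normal-form
witness).  `SuccinctLiftNaturalColumn.lean` proved `hard ⟹ pinned-hard` at every budget
(`perHardPinned_of_perHardSuccinct`); the converse at LINEAR budget `β n c = n + c` is the route's unfiled
`PaddingLift` (`A′ → A`).  THIS FILE proves the converse at POLYNOMIAL budget, so that the pin is a theorem-level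
artefact exactly at the top of the dial:

* §1 `exists_prefixTableCircuit` — a PREFIX TABLE: a list of length `≤ 2^k` is read off a `w`-bit address
  (`k ≤ w`) by a `B₂`-circuit with `≤ 5·2^k + 2(w - k) + 2` gates (Shannon table on the low `k` bits AND the
  zero test of the high `w - k` bits) — the width-robust form of `exists_tableCircuit` (`5 · 2^w` gates);
* §2 log bookkeeping: `2 · canonWidth n k + 2 ≤ n²/2 + n^k/2 + (k+27)/2 + 80` (`two_mul_canonWidth_le`);
* §3 `perEasyPinned_poly_of_perEasyCF` — constant-free easiness of `PER` at depth `Δ` with polynomially many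
  wires gives PINNED succinct easiness at polynomial description budget (normal form of
  `SuccinctLiftCircuitCodes.lean` + prefix table at the canonical width); hence
  `perHardPinned_poly_iff_perHardCF` — THE PINNED TOP NOTCH EQUALS THE TOP NOTCH `¬ PerEasyCF Δ` for every `Δ`,
  and at `Δ₁ = ⌊log₂ log₂ log₂ n⌋ + 1` the pinned top notch is the route's `PerHardLog3CF` verbatim
  (`perHardPinnedLog3_poly_iff`).  With `SuccinctLiftDescriptionDial.perEasyCF_iff_polySuccinct` (unpinned top
  notch = constant-free notch) this certifies in kernel that pinned and unpinned dials agree at budget `n^c + c`: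
  the padding phenomenon separating `A′ = PinnedPerHardLog3` from `A = SuccinctPerHardLog3` lives strictly below
  polynomial description budget.

No new definitions; no named facts; standard axioms.  References: Arora–Barak 2009 (`AroraBarakCC2009`, Claim 2.13:
every `k`-bit function has `O(2^k)` gates), Chen–Kabanets 2012 (`ChenKabanets2012`, Def. 2.1: width-indexed
succinctness), Jansen–Santhanam 2011 (`JansenSanthanam2011`, §1), Bürgisser 2000 (`Burgisser2000`, §1.4, Def. 2.1:
constant-free normal form and code length).
-/

namespace Summit.ValiantsHypothesis.ValiantsHypothesis.Theorems.SuccinctLift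

open Literature.Computability.AlgebraicComplexity Literature.Computability.Complexity Computability
open ArithCircuit

noncomputable section

/-! ### 1. Prefix table circuits -/

section PrefixTables

open Literature.Computability.Complexity.SelfCorrect (cktSize_eqConst)

/-- Reading a list of length `≤ 2^k` at a `(k + j)`-bit address = reading it at the low `k` bits, provided the
high `j` bits are zero (otherwise the address is out of range). [folklore] -/
theorem getD_addr_eq_and (k j : ℕ) (l : List Bool) (hl : l.length ≤ 2 ^ k) (a : Fin (k + j) → Bool) :
    l.getD (∑ t : Fin (k + j), if a t then 2 ^ (t : ℕ) else 0) false =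
      (l.getD (∑ t : Fin k, if a (Fin.castAdd j t) then 2 ^ (t : ℕ) else 0) false &&
        decide ((fun t : Fin j => a (Fin.natAdd k t)) = fun _ => false)) := by
  rw [Fin.sum_univ_add]
  simp only [Fin.val_castAdd, Fin.val_natAdd]
  by_cases hz : (fun t : Fin j => a (Fin.natAdd k t)) = fun _ => false
  · have h0 : ∑ t : Fin j, (if a (Fin.natAdd k t) then 2 ^ (k + (t : ℕ)) else 0) = 0 :=
      Finset.sum_eq_zero fun t _ => by
        have ht : a (Fin.natAdd k t) = false := congrFun hz t
        simp [ht]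
    rw [h0, add_zero, decide_eq_true hz, Bool.and_true]
  · obtain ⟨t, ht⟩ : ∃ t : Fin j, a (Fin.natAdd k t) = true := by
      by_contra hcon
      exact hz (funext fun t => eq_false_of_ne_true fun ht => hcon ⟨t, ht⟩)
    have h1 : 2 ^ (k + (t : ℕ)) ≤ ∑ t : Fin j, (if a (Fin.natAdd k t) then 2 ^ (k + (t : ℕ)) else 0) := by
      have := Finset.single_le_sum
        (f := fun t : Fin j => if a (Fin.natAdd k t) then 2 ^ (k + (t : ℕ)) else 0)
        (fun _ _ => Nat.zero_le _) (Finset.mem_univ t)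
      simpa [ht] using this
    have h2 : 2 ^ k ≤ 2 ^ (k + (t : ℕ)) := Nat.pow_le_pow_right (by norm_num) (Nat.le_add_right _ _)
    have hbig : l.length ≤ (∑ t : Fin k, if a (Fin.castAdd j t) then 2 ^ (t : ℕ) else 0) +
        ∑ t : Fin j, (if a (Fin.natAdd k t) then 2 ^ (k + (t : ℕ)) else 0) := by omega
    rw [decide_eq_false hz, Bool.and_false]
    unfold List.getD
    rw [List.getElem?_eq_none_iff.2 hbig]
    rfl

/-- **Prefix table circuits.** A list of length `≤ 2^k` is read off a `w`-bit little-endian address, `k ≤ w`, by a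
`B₂`-circuit with at most `5 · 2^k + 2 (w - k) + 2` gates: the Shannon-expansion table on the low `k` address bits
(`cktSize_univ_fin`) AND the test that the high `w - k` bits vanish. [cite: AroraBarakCC2009, Claim 2.13] -/
theorem exists_prefixTableCircuit {k w : ℕ} (hkw : k ≤ w) (l : List Bool) (hl : l.length ≤ 2 ^ k) :
    ∃ D : Literature.Computability.Complexity.Circuit (Fin w),
      D.IsOver Literature.Computability.Complexity.B2 ∧ D.size ≤ 5 * 2 ^ k + 2 * (w - k) + 2 ∧
        D.Computes fun a => l.getD (∑ t : Fin w, if a t then 2 ^ (t : ℕ) else 0) false := by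
  obtain ⟨j, rfl⟩ := Nat.exists_eq_add_of_le hkw
  -- the table on the low `k` address bits
  have hT : CktSize B2 (fun (a : Fin (k + j) → Bool) (_ : Unit) =>
      l.getD (∑ t : Fin k, if a (Fin.castAdd j t) then 2 ^ (t : ℕ) else 0) false) (univBound k) :=
    (cktSize_univ_fin k fun x _ => l.getD (∑ t : Fin k, if x t then 2 ^ (t : ℕ) else 0) false).rewire
      (Fin.castAdd j)
  -- the zero test of the high `j` address bits
  have hZ : CktSize B2 (fun (a : Fin (k + j) → Bool) (_ : Unit) =>
      decide ((fun t : Fin j => a (Fin.natAdd k t)) = fun _ => false)) (j * 1 + (j + 1)) :=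
    (cktSize_eqConst (m := j) fun _ => false).rewire (Fin.natAdd k)
  have hP : CktSize B2 (fun (a : Fin (k + j) → Bool) (_ : Unit) =>
      l.getD (∑ t : Fin (k + j), if a t then 2 ^ (t : ℕ) else 0) false)
      (univBound k + (j * 1 + (j + 1)) + 1) :=
    ((hT.pair hZ).comp (cktSize_and (ι := Unit ⊕ Unit) (.inl ()) (.inr ()))).congr fun a _ => by
      simp only [Sum.elim_inl, Sum.elim_inr]
      exact (getD_addr_eq_and k j l hl a).symm
  obtain ⟨D, hO, hs, hev⟩ := hP.toCircuit
  refine ⟨D, hO, ?_, fun a => hev a⟩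
  have hu := Literature.Computability.MetaComplexity.MCSPVerif.univBound_le k
  have hj : k + j - k = j := Nat.add_sub_cancel_left ..
  rw [hj]
  generalize 2 ^ k = T at hu ⊢
  generalize univBound k = U at hu hs
  omega

end PrefixTables

/-! ### 2. Log bookkeeping for the canonical width -/

section LogBounds

/-- `8 t ≤ 2^t + 40`. [folklore] -/
theorem eight_mul_le_two_pow_add (t : ℕ) : 8 * t ≤ 2 ^ t + 40 := by
  induction t with
  | zero => simp
  | succ t ih =>
    rcases Nat.lt_or_ge t 3 with h | h
    · interval_cases t <;> norm_num
    · have h8 : 8 ≤ 2 ^ t :=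
        calc (8 : ℕ) = 2 ^ 3 := by norm_num
          _ ≤ 2 ^ t := Nat.pow_le_pow_right (by norm_num) h
      rw [pow_succ]
      omega

/-- `4 ⌊log₂ m⌋ ≤ m / 2 + 20`. [folklore] -/
theorem four_mul_log_le (m : ℕ) : 4 * Nat.log 2 m ≤ m / 2 + 20 := by
  rcases Nat.eq_zero_or_pos m with rfl | hm
  · simp
  · have h1 := eight_mul_le_two_pow_add (Nat.log 2 m)
    have h2 : 2 ^ Nat.log 2 m ≤ m := Nat.pow_log_le_self 2 hm.ne'
    omega

/-- `⌊log₂ (x + y + z)⌋ ≤ ⌊log₂ x⌋ + ⌊log₂ y⌋ + ⌊log₂ z⌋ + 2`. [folklore] -/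
theorem log_add_three_le (x y z : ℕ) :
    Nat.log 2 (x + y + z) ≤ Nat.log 2 x + Nat.log 2 y + Nat.log 2 z + 2 := by
  set L := Nat.log 2 x + Nat.log 2 y + Nat.log 2 z with hL
  have hx : x < 2 ^ (Nat.log 2 x + 1) := Nat.lt_pow_succ_log_self one_lt_two x
  have hy : y < 2 ^ (Nat.log 2 y + 1) := Nat.lt_pow_succ_log_self one_lt_two y
  have hz : z < 2 ^ (Nat.log 2 z + 1) := Nat.lt_pow_succ_log_self one_lt_two z
  have hx' : 2 ^ (Nat.log 2 x + 1) ≤ 2 ^ (L + 1) := Nat.pow_le_pow_right (by norm_num) (by omega)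
  have hy' : 2 ^ (Nat.log 2 y + 1) ≤ 2 ^ (L + 1) := Nat.pow_le_pow_right (by norm_num) (by omega)
  have hz' : 2 ^ (Nat.log 2 z + 1) ≤ 2 ^ (L + 1) := Nat.pow_le_pow_right (by norm_num) (by omega)
  have hsum : x + y + z < 2 ^ (L + 3) := by
    have e : 2 ^ (L + 3) = 4 * 2 ^ (L + 1) := by ring
    omega
  rcases Nat.eq_zero_or_pos (x + y + z) with h0 | hpos
  · rw [h0, Nat.log_zero_right]
    exact Nat.zero_le _
  · have := Nat.log_lt_of_lt_pow hpos.ne' hsum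
    omega

/-- `⌊log₂ (8 X²)⌋ + 1 ≤ 2 ⌊log₂ X⌋ + 5`. [folklore] -/
theorem log_eight_mul_sq_le (X : ℕ) : Nat.log 2 (8 * X ^ 2) + 1 ≤ 2 * Nat.log 2 X + 5 := by
  rcases Nat.eq_zero_or_pos X with rfl | hX
  · simp
  · have hx : X < 2 ^ (Nat.log 2 X + 1) := Nat.lt_pow_succ_log_self one_lt_two X
    have h8 : 8 * X ^ 2 < 2 ^ (2 * Nat.log 2 X + 5) := by
      have e : 2 ^ (2 * Nat.log 2 X + 5) = 8 * (2 ^ (Nat.log 2 X + 1)) ^ 2 := by ring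
      rw [e]
      have := Nat.mul_lt_mul'' hx hx
      nlinarith
    have hne : 8 * X ^ 2 ≠ 0 := by positivity
    have := Nat.log_lt_of_lt_pow hne h8
    omega

/-- **The canonical width is logarithmic**: `2 · canonWidth n k + 2 ≤ n²/2 + n^k/2 + (k + 27)/2 + 80` — the cost
of the high-bit zero test of a prefix table at width `canonWidth n k` is absorbed by the polynomial budget.
[folklore] -/
theorem two_mul_canonWidth_le (n k : ℕ) :
    2 * canonWidth n k + 2 ≤ n * n / 2 + n ^ k / 2 + (k + 27) / 2 + 80 := by
  have e : codeLen n k = 8 * (n * n + n ^ k + (k + 27)) ^ 2 := by unfold codeLen; ring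
  unfold canonWidth
  rw [e]
  have h1 := log_eight_mul_sq_le (n * n + n ^ k + (k + 27))
  have h2 := log_add_three_le (n * n) (n ^ k) (k + 27)
  have h3 := four_mul_log_le (n * n)
  have h4 := four_mul_log_le (n ^ k)
  have h5 := four_mul_log_le (k + 27)
  omega

end LogBounds

/-! ### 3. The pinned top notch equals the top notch -/

section PinnedTop

/-- `codeLen` is monotone in the exponent. [folklore] -/
theorem codeLen_mono {c k : ℕ} (hck : c ≤ k) (n : ℕ) : codeLen n c ≤ codeLen n k := by
  unfold codeLen
  have := OrbitRestorationQPDepthThreeRung.vsbr_pbound_mono hck n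
  gcongr

/-- `canonWidth` is monotone in the exponent. [folklore] -/
theorem canonWidth_mono {c k : ℕ} (hck : c ≤ k) (n : ℕ) : canonWidth n c ≤ canonWidth n k := by
  unfold canonWidth
  have := Nat.log_mono_right (b := 2) (codeLen_mono hck n)
  omega

/-- **Pinned succinctness is free at polynomial budget.** If `PER` is easy for constant-free depth-`Δ` circuits with
`n^c + c` wires, then for some `k` and every `n`, `PER_n ∈ PinnedClass Δ n k (canonWidth n k) (n^k + k)`: a normal-form
witness has a code word of length `L ≤ codeLen n c`, and the prefix table for it at the canonical width
`canonWidth n k ≥ ⌊log₂ L⌋ + 1` has `≤ 10 L + 10 + 2 · canonWidth n k + 2 = poly(n)` gates.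
[cite: AroraBarakCC2009, Claim 2.13] -/
theorem perEasyPinned_poly_of_perEasyCF {Δ : ℕ → ℕ} (h : PerEasyCF Δ) :
    ∃ k : ℕ, ∀ n : ℕ, perPoly (Fin n) ℂ ∈ PinnedClass Δ n k (canonWidth n k) (n ^ k + k) := by
  obtain ⟨c, hc⟩ := h
  obtain ⟨k, hck, hk⟩ := exists_exp_dominating 216 c 27
  refine ⟨k, fun n => ?_⟩
  obtain ⟨C, C', hC', hsc, hcomp, hpd, hes⟩ := hc n
  obtain ⟨N, hwf, hsN, hev, hpdN, hesN, hszN⟩ := exists_normalForm_signConst C hsc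
  have hesC : C.edgeSize ≤ n ^ c + c := by
    rw [hC', DepthThreeChasm.edgeSize_rename, edgeSize_mapCoeff] at hes
    exact hes
  have hpdC : C.productDepth ≤ Δ n := by
    rw [hC', DepthThreeChasm.productDepth_rename, productDepth_mapCoeff] at hpd
    exact hpd
  have hNe : N.edgeSize ≤ n ^ c + c := hesN.trans hesC
  have hcl : codeLen n c = 8 * (n * n + n ^ c + c + 27) ^ 2 := by unfold codeLen; ring
  have hL : (encodeArithCircuit (n * n) N).length ≤ codeLen n c := by
    calc (encodeArithCircuit (n * n) N).length ≤ 8 * (n * n + N.edgeSize + 27) ^ 2 :=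
          length_encodeArithCircuit_le_sq N hwf hsN hszN
      _ ≤ 8 * (n * n + (n ^ c + c) + 27) ^ 2 := by gcongr
      _ = codeLen n c := rfl
  set L := (encodeArithCircuit (n * n) N).length with hLdef
  have hLw : L ≤ 2 ^ (Nat.log 2 L + 1) := (Nat.lt_pow_succ_log_self one_lt_two L).le
  have h2w : 2 ^ (Nat.log 2 L + 1) ≤ 2 * L + 2 := by
    rcases Nat.eq_zero_or_pos L with hL0 | hLpos
    · rw [hL0]; simp
    · have := Nat.pow_log_le_self 2 hLpos.ne'
      rw [pow_succ]; omega
  have hk0w : Nat.log 2 L + 1 ≤ canonWidth n k := by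
    have h1 : Nat.log 2 L + 1 ≤ canonWidth n c := by
      unfold canonWidth
      have := Nat.log_mono_right (b := 2) hL
      omega
    exact h1.trans (canonWidth_mono hck n)
  have hLW : L ≤ 2 ^ canonWidth n k := hLw.trans (Nat.pow_le_pow_right (by norm_num) hk0w)
  obtain ⟨D, hDO, hDs, hDc⟩ := exists_prefixTableCircuit hk0w (encodeArithCircuit (n * n) N) hLw
  refine ⟨N, (N.map (Int.castRingHom ℂ)).rename ⇑(finProdFinEquiv (m := n) (n := n)).symm, rfl,
    hsN, ?_, ?_, ?_, hLW, D, hDO, ?_, hDc⟩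
  · unfold ArithCircuit.Computes at hcomp ⊢
    rw [eval_rename_apply, eval_map_apply, hev, ← eval_map_apply, ← eval_rename_apply, ← hC']
    exact hcomp
  · rw [DepthThreeChasm.productDepth_rename, productDepth_mapCoeff]
    exact hpdN.trans hpdC
  · rw [DepthThreeChasm.edgeSize_rename, edgeSize_mapCoeff]
    exact hNe.trans (OrbitRestorationQPDepthThreeRung.vsbr_pbound_mono hck n)
  · have hkn := hk n
    have hw := two_mul_canonWidth_le n k
    have hm : n * n ≤ n * n + n ^ c + c + 27 := by
      rw [add_assoc, add_assoc]
      exact Nat.le_add_right _ _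
    have hQ : n * n ≤ (n * n + n ^ c + c + 27) ^ 2 := hm.trans (Nat.le_self_pow two_ne_zero _)
    have hL8 : L ≤ 8 * (n * n + n ^ c + c + 27) ^ 2 := hL.trans hcl.le
    show D.size ≤ n ^ k + k
    clear hDc hDO hcomp hev hC' hLW hk hc
    generalize (n * n + n ^ c + c + 27) ^ 2 = Q at hkn hQ hL8
    generalize n * n = M at hw hQ
    generalize n ^ k = P at hkn hw ⊢
    generalize Nat.log 2 L = l₀ at hLw h2w hDs hk0w
    generalize 2 ^ (l₀ + 1) = T at hLw h2w hDs
    omega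

/-- **THE PINNED TOP NOTCH IS THE TOP NOTCH** (every depth function `Δ`): `PER` is hard for the width-pinned notch at
polynomial description budget iff `PER` is hard for constant-free depth-`Δ` circuits with polynomially many wires.
With `SuccinctLiftDescriptionDial.perHardCF_iff_polySuccinctHard` (unpinned top notch = constant-free notch) the
pinned and the unpinned dial AGREE at budget `n^c + c`; they are only known to satisfy `hard ⟹ pinned-hard` at
smaller budgets (`perHardPinned_of_perHardSuccinct`). [cite: ChenKabanets2012, Def. 2.1] -/
theorem perHardPinned_poly_iff_perHardCF (Δ : ℕ → ℕ) :
    (¬ ∃ c : ℕ, ∀ n : ℕ, perPoly (Fin n) ℂ ∈ PinnedClass Δ n c (canonWidth n c) (n ^ c + c)) ↔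
      ¬ PerEasyCF Δ :=
  not_congr
    ⟨fun h => perEasyCF_of_succinct (perEasySuccinctCF_of_pinned (β := fun n c => n ^ c + c) h),
      perEasyPinned_poly_of_perEasyCF⟩

/-- The pinned top notch equals the unpinned top notch (both equal the constant-free notch).
[cite: ChenKabanets2012, Def. 2.1] -/
theorem perHardPinned_poly_iff_perHardDesc_poly (Δ : ℕ → ℕ) :
    (¬ ∃ c : ℕ, ∀ n : ℕ, perPoly (Fin n) ℂ ∈ PinnedClass Δ n c (canonWidth n c) (n ^ c + c)) ↔
      ¬ PerEasySuccinctCF (fun n c => n ^ c + c) Δ :=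
  (perHardPinned_poly_iff_perHardCF Δ).trans (perHardCF_iff_polySuccinctHard Δ)

/-- **At `Δ₁ = ⌊log₂ log₂ log₂ n⌋ + 1`**: the pinned top notch is the route's top notch `PerHardLog3CF`
(`= ¬ PerEasyCF Δ₁`, route file) — the padding phenomenon separating the asides `A′ = PinnedPerHardLog3` and
`A = SuccinctPerHardLog3` (budget `n + c`) is absent at budget `n^c + c`. [cite: ChenKabanets2012, Def. 2.1] -/
theorem perHardPinnedLog3_poly_iff :
    (¬ ∃ c : ℕ, ∀ n : ℕ, perPoly (Fin n) ℂ ∈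
        PinnedClass (fun n => Nat.log 2 (Nat.log 2 (Nat.log 2 n)) + 1) n c (canonWidth n c) (n ^ c + c)) ↔
      ¬ PerEasyCF (fun n => Nat.log 2 (Nat.log 2 (Nat.log 2 n)) + 1) :=
  perHardPinned_poly_iff_perHardCF _

end PinnedTop

end

end Summit.ValiantsHypothesis.ValiantsHypothesis.Theorems.SuccinctLift
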